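import Mathlib.Analysis.SpecialFunctions.Trigonometric.Basic
import HarnessLib

/-!
# N15 = NE2, road (c) — PROGRAMME (PC), towards (PC-B): two real-arithmetic lemmas for n15-c∕295 — the closeness constant of n15-c∕292's majorant under the site smallness, and
# n15-c∕260 `cvSmall` with its internals exported (dag-n15-c g27, n15-c∕295a)

Cell `pub-ymgap`, seat `pub-ymgap-dag-n15-c` (generation g27; R134 (a), s1; HUMAN RULING D-0062).  `bears_on: R4∕N15 · K3⁸ SpineGivenEndpointR13SepCoPHV (stmt-QuantumFields-27366)`;
filed `--kind proof --supports stmt-QuantumFields-27366 --as helper` — COUNT-NEUTRAL.  Elementary real inequalities only (Mathlib); 0 `def`, 0 `sorry`.  `cvSmallE` is n15-c∕260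
`…TwoSpacingGluingCurvedKnitObjects`'s `cvSmall` with the SAME hypotheses and its proof verbatim, returning the four internal facts (`E ≤ e₁∕w + e₂θ_F`, `E ≤ ½`, `B ≤ B̄`,
`(1 − E)⁻¹ ≤ 2`) that `cvSmall` consumes; `closeMaj_le` turns n15-c∕292's near∕far constant into ONE `w`-free constant times `(R_c + w⁻¹ + θ_F + t)`.

HONEST FRAMING ∕ LIMITS.  Arithmetic; nothing of record touched; NE2⁺ NOT PRINTED, NOT proved; K3⁸ OPEN; counts UNMOVED.  Restate-immune (no Theses import).
-/

noncomputable section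

namespace Summit.QuantumFields.YangMills.BalabanUVNodes.N15.Gluing

open Real

/-! ## §1 Two real-arithmetic lemmas: the closeness constant, and n15-c∕260's smallness with its internals exported -/

/-- the near∕far constant of n15-c∕292's majorant under the site smallness: `E = N_ov(cθ + cε)c_r ≤ ½`, `E ≤ e₁w⁻¹ + e₂θ_F`, `B ≤ B̄`, `(1 − E)⁻¹ ≤ 2`, `β̄_w ≤ β̄` ⟹ it is at most
`B_out·(R_c + w⁻¹ + θ_F + t)` with ONE `w`-free constant. [folklore] -/

theorem closeMaj_le {Nov c B Bb I cr βw βb θ ε E t Rc e₁ e₂ w θF : ℝ}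
    (hNov : 0 ≤ Nov) (hc : 0 ≤ c) (hB0 : 0 ≤ B) (hBb : B ≤ Bb) (hBb0 : 0 ≤ Bb) (hI0 : 0 ≤ I) (hI2 : I ≤ 2) (hcr : 0 ≤ cr) (hβw0 : 0 ≤ βw) (hβw : βw ≤ βb)
    (hθ : 0 ≤ θ) (hε : 0 ≤ ε) (hEdef : Nov * (c * θ + c * ε) * cr = E) (hE2 : E ≤ 1 / 2) (ht0 : 0 ≤ t) (hRc : 0 ≤ Rc)
    (he₁ : 0 ≤ e₁) (he₂ : 0 ≤ e₂) (hw : 0 < w) (hθF : 0 ≤ θF) (hE1 : E ≤ e₁ * w⁻¹ + e₂ * θF) :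
    (Nov * (c * (2 * (βw * (Rc * B * cr) * cr))) + Nov * (c * B) * (I * cr) * (Nov * (c * (2 * θ) + c * (2 * ε))) * cr) * (I * cr) +
        (Nov * (2 * (c * B)) + Nov * (c * B) * (I * cr) * (Nov * (2 * (c * ε)) + Nov * (2 * (c * θ))) * cr) * (I * cr) * t ≤
      (2 * cr * (2 * (Nov * (c * (βb * (Bb * cr) * cr)))) + 8 * cr * cr * (Nov * (c * Bb)) * e₁ + 8 * cr * cr * (Nov * (c * Bb)) * e₂ +
          (2 * (Nov * (c * Bb)) + Nov * (c * Bb) * (2 * cr)) * (2 * cr) + 1) * ((Rc + w⁻¹) + θF + t) := by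
  have hP : Nov * (c * B) ≤ Nov * (c * Bb) := mul_le_mul_of_nonneg_left (mul_le_mul_of_nonneg_left hBb hc) hNov
  have hIc : I * cr ≤ 2 * cr := mul_le_mul_of_nonneg_right hI2 hcr
  have hE0 : 0 ≤ E := by rw [← hEdef]; positivity
  have hwi : 0 ≤ w⁻¹ := inv_nonneg.2 hw.le
  have e1 : ∀ A : ℝ, A * (Nov * (c * (2 * θ) + c * (2 * ε))) * cr = A * (2 * E) := fun A => by rw [← hEdef]; ring
  have e2 : ∀ A : ℝ, A * (Nov * (2 * (c * ε)) + Nov * (2 * (c * θ))) * cr = A * (2 * E) := fun A => by rw [← hEdef]; ring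
  rw [e1, e2]
  have h2E : 2 * E ≤ 1 := by linarith
  have hA : Nov * (c * (2 * (βw * (Rc * B * cr) * cr))) ≤ 2 * (Nov * (c * (βb * (Bb * cr) * cr))) * Rc := by
    have h := mul_le_mul hβw hBb hB0 (hβw0.trans hβw)
    calc Nov * (c * (2 * (βw * (Rc * B * cr) * cr))) = (βw * B) * (2 * Nov * c * cr * cr * Rc) := by ring
      _ ≤ (βb * Bb) * (2 * Nov * c * cr * cr * Rc) := mul_le_mul_of_nonneg_right h (by positivity)
      _ = 2 * (Nov * (c * (βb * (Bb * cr) * cr))) * Rc := by ring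
  have h2P : Nov * (2 * (c * B)) ≤ 2 * (Nov * (c * Bb)) := by
    rw [show Nov * (2 * (c * B)) = 2 * (Nov * (c * B)) by ring]; exact mul_le_mul_of_nonneg_left hP zero_le_two
  have hβb0 : 0 ≤ βb := hβw0.trans hβw
  have P0 : 0 ≤ Nov * (c * Bb) := by positivity
  have step1 : (Nov * (c * (2 * (βw * (Rc * B * cr) * cr))) + Nov * (c * B) * (I * cr) * (2 * E)) * (I * cr) +
        (Nov * (2 * (c * B)) + Nov * (c * B) * (I * cr) * (2 * E)) * (I * cr) * t ≤
      (2 * (Nov * (c * (βb * (Bb * cr) * cr))) * Rc + Nov * (c * Bb) * (2 * cr) * (2 * (e₁ * w⁻¹ + e₂ * θF))) * (2 * cr) +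
        (2 * (Nov * (c * Bb)) + Nov * (c * Bb) * (2 * cr) * 1) * (2 * cr) * t := by
    gcongr
  have eq : (2 * (Nov * (c * (βb * (Bb * cr) * cr))) * Rc + Nov * (c * Bb) * (2 * cr) * (2 * (e₁ * w⁻¹ + e₂ * θF))) * (2 * cr) +
        (2 * (Nov * (c * Bb)) + Nov * (c * Bb) * (2 * cr) * 1) * (2 * cr) * t =
      (2 * cr * (2 * (Nov * (c * (βb * (Bb * cr) * cr))))) * Rc + (8 * cr * cr * (Nov * (c * Bb)) * e₁) * w⁻¹ + (8 * cr * cr * (Nov * (c * Bb)) * e₂) * θF +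
        ((2 * (Nov * (c * Bb)) + Nov * (c * Bb) * (2 * cr)) * (2 * cr)) * t := by ring
  have T1 : 0 ≤ 2 * cr * (2 * (Nov * (c * (βb * (Bb * cr) * cr)))) := by positivity
  have T2 : 0 ≤ 8 * cr * cr * (Nov * (c * Bb)) * e₁ := by positivity
  have T3 : 0 ≤ 8 * cr * cr * (Nov * (c * Bb)) * e₂ := by positivity
  have T4 : 0 ≤ (2 * (Nov * (c * Bb)) + Nov * (c * Bb) * (2 * cr)) * (2 * cr) := by positivity
  have f1 : (2 * cr * (2 * (Nov * (c * (βb * (Bb * cr) * cr))))) * Rc ≤ (2 * cr * (2 * (Nov * (c * (βb * (Bb * cr) * cr)))) + 8 * cr * cr * (Nov * (c * Bb)) * e₁ + 8 * cr * cr * (Nov * (c * Bb)) * e₂ +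
          (2 * (Nov * (c * Bb)) + Nov * (c * Bb) * (2 * cr)) * (2 * cr) + 1) * Rc := mul_le_mul_of_nonneg_right (by linarith) hRc
  have f2 : (8 * cr * cr * (Nov * (c * Bb)) * e₁) * w⁻¹ ≤ (2 * cr * (2 * (Nov * (c * (βb * (Bb * cr) * cr)))) + 8 * cr * cr * (Nov * (c * Bb)) * e₁ + 8 * cr * cr * (Nov * (c * Bb)) * e₂ +
          (2 * (Nov * (c * Bb)) + Nov * (c * Bb) * (2 * cr)) * (2 * cr) + 1) * w⁻¹ := mul_le_mul_of_nonneg_right (by linarith) hwi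
  have f3 : (8 * cr * cr * (Nov * (c * Bb)) * e₂) * θF ≤ (2 * cr * (2 * (Nov * (c * (βb * (Bb * cr) * cr)))) + 8 * cr * cr * (Nov * (c * Bb)) * e₁ + 8 * cr * cr * (Nov * (c * Bb)) * e₂ +
          (2 * (Nov * (c * Bb)) + Nov * (c * Bb) * (2 * cr)) * (2 * cr) + 1) * θF := mul_le_mul_of_nonneg_right (by linarith) hθF
  have f4 : ((2 * (Nov * (c * Bb)) + Nov * (c * Bb) * (2 * cr)) * (2 * cr)) * t ≤ (2 * cr * (2 * (Nov * (c * (βb * (Bb * cr) * cr)))) + 8 * cr * cr * (Nov * (c * Bb)) * e₁ + 8 * cr * cr * (Nov * (c * Bb)) * e₂ +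
          (2 * (Nov * (c * Bb)) + Nov * (c * Bb) * (2 * cr)) * (2 * cr) + 1) * t := mul_le_mul_of_nonneg_right (by linarith) ht0
  rw [eq] at step1
  refine step1.trans ?_
  have esum : ∀ Bf : ℝ, Bf * ((Rc + w⁻¹) + θF + t) = Bf * Rc + Bf * w⁻¹ + Bf * θF + Bf * t := fun Bf => by ring
  rw [esum]
  linarith [f1, f2, f3, f4]

/-- n15-c∕260 `cvSmall`'s internals EXPORTED: the same hypotheses give `E ≤ (N_ovc_rc(A₁ + A₂ + 2κ))∕w + N_ovc_rc·θ_F·B̄·c_r`, `E ≤ ½`, `B ≤ B̄ = 2(β + β₁ + πβ)` and `(1 − E)⁻¹ ≤ 2` (its proof, verbatim,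
with the four facts returned instead of consumed). [folklore] -/

theorem cvSmallE {Nov cr cι2 cJ β β₁ w R θF ε₀ ε E' cN₀ D κ : ℝ} (hNov : 0 ≤ Nov) (hcr : 0 ≤ cr) (hcι : 0 ≤ cι2) (hcJ : 0 ≤ cJ) (hβ : 0 ≤ β) (hβ₁ : 0 ≤ β₁) (hw : 1 ≤ w)
    (hR : 0 ≤ R) (hθF : 0 ≤ θF) (hε : 0 < ε) (hE' : 0 ≤ E') (hcN₀ : 0 ≤ cN₀) (hD : 0 ≤ D) (hκ : 0 ≤ κ)
    (hq₀ : (β + (β₁ + π / w * β)) * (R * cr) * cr ≤ 1 / 2) (hθ : Nov * cr * (cι2 * (θF * (2 * (β + (β₁ + π * β))) * cr)) ≤ 1 / 4) (hε₀w : ε₀ ≤ κ / w)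
    (hW : 4 * (Nov * cr * (cι2 * ((cJ * (32 * π ^ 2 * (2 * (β + (β₁ + π * β))) + 2 * (π * (2 * (β + (β₁ + π * β))))) + (π * D * E' + 2 * (π * D)) * cN₀ * (2 * (β + (β₁ + π * β))) * cr) +
      ((π * D * (Real.exp 1 * ε)⁻¹ + 2 * (π * D + π * D * 1)) * R * (2 * (β + (β₁ + π * β))) * cr + R * π * (2 * (β + (β₁ + π * β))) * cr) + 2 * κ))) ≤ w) :
    Nov * (cι2 * (((cJ * ((32 * π ^ 2 / w ^ 2) * ((β + (β₁ + (π / w) * β)) * (1 - (β + (β₁ + (π / w) * β)) * (R * cr) * cr)⁻¹) + 2 * ((π / w) * ((β + (β₁ + (π / w) * β)) * (1 - (β + (β₁ + (π / w) * β)) * (R * cr) * cr)⁻¹))) + (0:ℝ) + ((π * D / w * E' + 2 * (π * D / w)) * cN₀) * ((β + (β₁ + (π / w) * β)) * (1 - (β + (β₁ + (π / w) * β)) * (R * cr) * cr)⁻¹) * cr)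
          + (((π * D / w) * (Real.exp 1 * ε)⁻¹ + 2 * ((π * D / w) + (π * D / w) * (1:ℝ))) * R * ((β + (β₁ + (π / w) * β)) * (1 - (β + (β₁ + (π / w) * β)) * (R * cr) * cr)⁻¹) * cr + R * (π / w) * ((β + (β₁ + (π / w) * β)) * (1 - (β + (β₁ + (π / w) * β)) * (R * cr) * cr)⁻¹) * cr)) + (θF * (1 * ((β + (β₁ + (π / w) * β)) * (1 - (β + (β₁ + (π / w) * β)) * (R * cr) * cr)⁻¹)) * cr)) + cι2 * ((ε₀ * (1 - (β + (β₁ + (π / w) * β)) * (R * cr) * cr)⁻¹) + 0)) * cr ≤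
        Nov * (cι2 * ((cJ * (32 * π ^ 2 * (2 * (β + (β₁ + π * β))) + 2 * (π * (2 * (β + (β₁ + π * β))))) + (π * D * E' + 2 * (π * D)) * cN₀ * (2 * (β + (β₁ + π * β))) * cr) / w + ((π * D * (Real.exp 1 * ε)⁻¹ + 2 * (π * D + π * D * 1)) * R * (2 * (β + (β₁ + π * β))) * cr + R * π * (2 * (β + (β₁ + π * β))) * cr) / w) + cι2 * (2 * κ / w)) * cr + Nov * (cι2 * (θF * (1 * (2 * (β + (β₁ + π * β)))) * cr)) * cr ∧
      Nov * (cι2 * (((cJ * ((32 * π ^ 2 / w ^ 2) * ((β + (β₁ + (π / w) * β)) * (1 - (β + (β₁ + (π / w) * β)) * (R * cr) * cr)⁻¹) + 2 * ((π / w) * ((β + (β₁ + (π / w) * β)) * (1 - (β + (β₁ + (π / w) * β)) * (R * cr) * cr)⁻¹))) + (0:ℝ) + ((π * D / w * E' + 2 * (π * D / w)) * cN₀) * ((β + (β₁ + (π / w) * β)) * (1 - (β + (β₁ + (π / w) * β)) * (R * cr) * cr)⁻¹) * cr)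
          + (((π * D / w) * (Real.exp 1 * ε)⁻¹ + 2 * ((π * D / w) + (π * D / w) * (1:ℝ))) * R * ((β + (β₁ + (π / w) * β)) * (1 - (β + (β₁ + (π / w) * β)) * (R * cr) * cr)⁻¹) * cr + R * (π / w) * ((β + (β₁ + (π / w) * β)) * (1 - (β + (β₁ + (π / w) * β)) * (R * cr) * cr)⁻¹) * cr)) + (θF * (1 * ((β + (β₁ + (π / w) * β)) * (1 - (β + (β₁ + (π / w) * β)) * (R * cr) * cr)⁻¹)) * cr)) + cι2 * ((ε₀ * (1 - (β + (β₁ + (π / w) * β)) * (R * cr) * cr)⁻¹) + 0)) * cr ≤ 1 / 2 ∧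
      (β + (β₁ + (π / w) * β)) * (1 - (β + (β₁ + (π / w) * β)) * (R * cr) * cr)⁻¹ ≤ (2 * (β + (β₁ + π * β))) ∧
      (1 - (Nov * (cι2 * (((cJ * ((32 * π ^ 2 / w ^ 2) * ((β + (β₁ + (π / w) * β)) * (1 - (β + (β₁ + (π / w) * β)) * (R * cr) * cr)⁻¹) + 2 * ((π / w) * ((β + (β₁ + (π / w) * β)) * (1 - (β + (β₁ + (π / w) * β)) * (R * cr) * cr)⁻¹))) + (0:ℝ) + ((π * D / w * E' + 2 * (π * D / w)) * cN₀) * ((β + (β₁ + (π / w) * β)) * (1 - (β + (β₁ + (π / w) * β)) * (R * cr) * cr)⁻¹) * cr)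
          + (((π * D / w) * (Real.exp 1 * ε)⁻¹ + 2 * ((π * D / w) + (π * D / w) * (1:ℝ))) * R * ((β + (β₁ + (π / w) * β)) * (1 - (β + (β₁ + (π / w) * β)) * (R * cr) * cr)⁻¹) * cr + R * (π / w) * ((β + (β₁ + (π / w) * β)) * (1 - (β + (β₁ + (π / w) * β)) * (R * cr) * cr)⁻¹) * cr)) + (θF * (1 * ((β + (β₁ + (π / w) * β)) * (1 - (β + (β₁ + (π / w) * β)) * (R * cr) * cr)⁻¹)) * cr)) + cι2 * ((ε₀ * (1 - (β + (β₁ + (π / w) * β)) * (R * cr) * cr)⁻¹) + 0)) * cr))⁻¹ ≤ 2 := by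
  have hw0 : 0 < w := by linarith
  -- the resummation factor `(1 − q₀)⁻¹ ≤ 2` and the cube letter `B ≤ B̄ = 2(β + β₁ + πβ)`
  set q₀ : ℝ := (β + (β₁ + (π / w) * β)) * (R * cr) * cr with hq₀def
  have hinv : (1 - q₀)⁻¹ ≤ 2 := by
    calc (1 - q₀)⁻¹ ≤ (1 / 2)⁻¹ := inv_anti₀ (by norm_num) (by linarith)
      _ = 2 := by norm_num
  have hinv0 : 0 ≤ (1 - q₀)⁻¹ := inv_nonneg.mpr (by linarith)
  have hπw : π / w ≤ π := div_le_self pi_pos.le hw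
  have hβs : β + (β₁ + (π / w) * β) ≤ β + (β₁ + π * β) := by
    have := mul_le_mul_of_nonneg_right hπw hβ
    linarith
  have hβs0 : 0 ≤ β + (β₁ + (π / w) * β) := by positivity
  set B : ℝ := (β + (β₁ + (π / w) * β)) * (1 - q₀)⁻¹ with hBdef
  set Bb : ℝ := 2 * (β + (β₁ + π * β)) with hBbdef
  have hB0 : 0 ≤ B := mul_nonneg hβs0 hinv0
  have hB : B ≤ Bb := by
    calc B ≤ (β + (β₁ + π * β)) * 2 := mul_le_mul hβs hinv hinv0 (by positivity)
      _ = Bb := by rw [hBbdef]; ring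
  have hBb0 : 0 ≤ Bb := by positivity
  -- the four pieces
  have hc₂ : 32 * π ^ 2 / w ^ 2 ≤ 32 * π ^ 2 / w := div_le_div_of_nonneg_left (by positivity) hw0 (by nlinarith)
  have hT1 : cJ * ((32 * π ^ 2 / w ^ 2) * B + 2 * ((π / w) * B)) + (0:ℝ) + ((π * D / w * E' + 2 * (π * D / w)) * cN₀) * B * cr ≤
      cJ * (32 * π ^ 2 / w * Bb + 2 * (π / w * Bb)) + 0 + ((π * D / w * E' + 2 * (π * D / w)) * cN₀) * Bb * cr := by
    have h1 : 32 * π ^ 2 / w ^ 2 * B ≤ 32 * π ^ 2 / w * Bb := mul_le_mul hc₂ hB hB0 (by positivity)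
    have h2 : π / w * B ≤ π / w * Bb := mul_le_mul_of_nonneg_left hB (by positivity)
    have h3 : ((π * D / w * E' + 2 * (π * D / w)) * cN₀) * B * cr ≤ ((π * D / w * E' + 2 * (π * D / w)) * cN₀) * Bb * cr :=
      mul_le_mul_of_nonneg_right (mul_le_mul_of_nonneg_left hB (by positivity)) hcr
    have h12 : cJ * ((32 * π ^ 2 / w ^ 2) * B + 2 * ((π / w) * B)) ≤ cJ * (32 * π ^ 2 / w * Bb + 2 * (π / w * Bb)) := mul_le_mul_of_nonneg_left (by linarith) hcJ
    linarith
  have hT2 : ((π * D / w) * (Real.exp 1 * ε)⁻¹ + 2 * ((π * D / w) + (π * D / w) * (1:ℝ))) * R * B * cr + R * (π / w) * B * cr ≤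
      ((π * D / w) * (Real.exp 1 * ε)⁻¹ + 2 * ((π * D / w) + (π * D / w) * (1:ℝ))) * R * Bb * cr + R * (π / w) * Bb * cr := by
    have hE0 : 0 ≤ (Real.exp 1 * ε)⁻¹ := by positivity
    have h1 : ((π * D / w) * (Real.exp 1 * ε)⁻¹ + 2 * ((π * D / w) + (π * D / w) * (1:ℝ))) * R * B * cr ≤ ((π * D / w) * (Real.exp 1 * ε)⁻¹ + 2 * ((π * D / w) + (π * D / w) * (1:ℝ))) * R * Bb * cr :=
      mul_le_mul_of_nonneg_right (mul_le_mul_of_nonneg_left hB (by positivity)) hcr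
    have h2 : R * (π / w) * B * cr ≤ R * (π / w) * Bb * cr := mul_le_mul_of_nonneg_right (mul_le_mul_of_nonneg_left hB (by positivity)) hcr
    linarith
  have hT3 : θF * (1 * B) * cr ≤ θF * (1 * Bb) * cr := mul_le_mul_of_nonneg_right (mul_le_mul_of_nonneg_left (by linarith) hθF) hcr
  have hT4 : ε₀ * (1 - q₀)⁻¹ + 0 ≤ 2 * κ / w := by
    have := mul_le_mul hε₀w hinv hinv0 (by positivity : 0 ≤ κ / w)
    rw [add_zero]
    calc ε₀ * (1 - q₀)⁻¹ ≤ κ / w * 2 := this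
      _ = 2 * κ / w := by ring
  -- the `w⁻¹` pieces as ONE fraction
  set A₁ : ℝ := cJ * (32 * π ^ 2 * Bb + 2 * (π * Bb)) + (π * D * E' + 2 * (π * D)) * cN₀ * Bb * cr with hA₁
  set A₂ : ℝ := (π * D * (Real.exp 1 * ε)⁻¹ + 2 * (π * D + π * D * 1)) * R * Bb * cr + R * π * Bb * cr with hA₂
  have eT1 : cJ * (32 * π ^ 2 / w * Bb + 2 * (π / w * Bb)) + 0 + ((π * D / w * E' + 2 * (π * D / w)) * cN₀) * Bb * cr = A₁ / w := by
    rw [hA₁]; field_simp; ring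
  have eT2 : ((π * D / w) * (Real.exp 1 * ε)⁻¹ + 2 * ((π * D / w) + (π * D / w) * (1:ℝ))) * R * Bb * cr + R * (π / w) * Bb * cr = A₂ / w := by
    rw [hA₂]; field_simp
  have hA₁0 : 0 ≤ A₁ := by positivity
  have hA₂0 : 0 ≤ A₂ := by positivity
  -- assemble
  have hsum : Nov * (cι2 * (((cJ * ((32 * π ^ 2 / w ^ 2) * B + 2 * ((π / w) * B)) + (0:ℝ) + ((π * D / w * E' + 2 * (π * D / w)) * cN₀) * B * cr)
          + (((π * D / w) * (Real.exp 1 * ε)⁻¹ + 2 * ((π * D / w) + (π * D / w) * (1:ℝ))) * R * B * cr + R * (π / w) * B * cr)) + (θF * (1 * B) * cr)) + cι2 * ((ε₀ * (1 - q₀)⁻¹) + 0)) * cr ≤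
      Nov * (cι2 * ((A₁ / w + A₂ / w) + θF * (1 * Bb) * cr) + cι2 * (2 * κ / w)) * cr := by
    have hin : ((cJ * ((32 * π ^ 2 / w ^ 2) * B + 2 * ((π / w) * B)) + (0:ℝ) + ((π * D / w * E' + 2 * (π * D / w)) * cN₀) * B * cr)
          + (((π * D / w) * (Real.exp 1 * ε)⁻¹ + 2 * ((π * D / w) + (π * D / w) * (1:ℝ))) * R * B * cr + R * (π / w) * B * cr)) ≤ A₁ / w + A₂ / w := by
      rw [← eT1, ← eT2]
      exact add_le_add hT1 hT2
    have hin3 : cι2 * (((cJ * ((32 * π ^ 2 / w ^ 2) * B + 2 * ((π / w) * B)) + (0:ℝ) + ((π * D / w * E' + 2 * (π * D / w)) * cN₀) * B * cr)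
          + (((π * D / w) * (Real.exp 1 * ε)⁻¹ + 2 * ((π * D / w) + (π * D / w) * (1:ℝ))) * R * B * cr + R * (π / w) * B * cr)) + (θF * (1 * B) * cr)) ≤ cι2 * ((A₁ / w + A₂ / w) + θF * (1 * Bb) * cr) := mul_le_mul_of_nonneg_left (add_le_add hin hT3) hcι
    have hin4 : cι2 * ((ε₀ * (1 - q₀)⁻¹) + 0) ≤ cι2 * (2 * κ / w) := mul_le_mul_of_nonneg_left hT4 hcι
    exact mul_le_mul_of_nonneg_right (mul_le_mul_of_nonneg_left (add_le_add hin3 hin4) hNov) hcr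
  have hfrac : Nov * (cι2 * (A₁ / w + A₂ / w) + cι2 * (2 * κ / w)) * cr ≤ 1 / 4 := by
    have e : Nov * (cι2 * (A₁ / w + A₂ / w) + cι2 * (2 * κ / w)) * cr = Nov * cr * (cι2 * (A₁ + A₂ + 2 * κ)) / w := by
      field_simp
    rw [e, div_le_iff₀ hw0]
    linarith
  have hfar : Nov * (cι2 * (θF * (1 * Bb) * cr)) * cr ≤ 1 / 4 := by
    have e : Nov * (cι2 * (θF * (1 * Bb) * cr)) * cr = Nov * cr * (cι2 * (θF * Bb * cr)) := by ring
    rw [e]; exact hθ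
  have esplit : Nov * (cι2 * ((A₁ / w + A₂ / w) + θF * (1 * Bb) * cr) + cι2 * (2 * κ / w)) * cr =
      Nov * (cι2 * (A₁ / w + A₂ / w) + cι2 * (2 * κ / w)) * cr + Nov * (cι2 * (θF * (1 * Bb) * cr)) * cr := by ring
  have hE := hsum.trans (show Nov * (cι2 * ((A₁ / w + A₂ / w) + θF * (1 * Bb) * cr) + cι2 * (2 * κ / w)) * cr ≤ 1 / 2 by linarith)
  refine ⟨by rw [← esplit]; exact hsum, hE, hB, ?_⟩
  calc (1 - (Nov * (cι2 * (((cJ * ((32 * π ^ 2 / w ^ 2) * B + 2 * ((π / w) * B)) + (0:ℝ) + ((π * D / w * E' + 2 * (π * D / w)) * cN₀) * B * cr)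
          + (((π * D / w) * (Real.exp 1 * ε)⁻¹ + 2 * ((π * D / w) + (π * D / w) * (1:ℝ))) * R * B * cr + R * (π / w) * B * cr)) + (θF * (1 * B) * cr)) + cι2 * ((ε₀ * (1 - q₀)⁻¹) + 0)) * cr))⁻¹
      ≤ (1 / 2)⁻¹ := inv_anti₀ (by norm_num) (by linarith)
    _ = 2 := by norm_num

end Summit.QuantumFields.YangMills.BalabanUVNodes.N15.Gluing

end
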